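import Literature.NumberTheory.EllipticCurves.KatoAdditiveTwistedValueNeronIntegralitySymbolClosure
import Literature.NumberTheory.EllipticCurves.ManinConstantClassCertificate
import Literature.NumberTheory.EllipticCurves.Isogeny
import Literature.NumberTheory.EllipticCurves.ModularSymbols
import HarnessLib
import HarnessLib.Audit.Tags

/-!
# «THE PERIOD-LATTICE LAW ON THE UNIT-TWIST CM FAMILIES» — rows E-es-132-U2 / E-es-132-U3 typed
# (cell `bsd-f2-manin`, planner `es` g28, MEMO-es §42.19; lever MEMO-imc §12; T-es-44c; nothing asserted)

TYPER NOTE (typer g19, T-es-44c).  SOURCE = HOME/es/g28/Sketch-es-g28.lean v5 sha16 383cc987232501d4 §7 (`section UnitTwistFamilies`; the two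
`def`s byte-identical to v4 b91eca3c9a247405, BC7 CLEAN; es: farm rc 0 · 0 warn), landed VERBATIM (the v5 §7 docstrings, which credit the lever to
MEMO-imc §12 — NOT the v4 wording) except: this note; namespace `BsdF2ManinEsG28` → `Summit.BirchSwinnertonDyer.Rank1Residual.ManinAdditive.KatoCurve.CMOptimal`
(sibling of `CMOptimalCoordinates.lean`, p710672 = §5–§6 of the same sketch); `@[conjecture]` added on the two `def … : Prop` (obligation nodes,
nothing asserted); imports = those of `CMOptimalCoordinates.lean` (Literature only) — ROUTE-INDEPENDENT.

HONEST FRAMING.  LENS: es (explicit reciprocity on the CM residual; here the Γ₀/Γ₁ twisting inclusion LEMMA⁺ = tree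
`GaussSumMulMemGamma1OfMemGamma0Twist_holds` (imc E-imc-15/16, PROVED) + Stevens 1989).  STATUS: E-es-132-U2/U3 are, per es 42.19 and imc §12,
PRINT + TREE COROLLARIES in waiting (instances of E-imc-17 `OptimalIsMinimalOfTwist` ∧ `c₀ = 1` at the roots 32a/64a/27a): what a prover still
needs is (α) the Atkin–Li identification of the newform of `V` with `charTwist (M D²) … f_root`, (β) iteration of Stevens (5.2) over the prime
factors of `D`, (γ) the cite-tagged fact Stevens 1989 Thm (7.1) (Conjecture I″ for conductor ≤ 200) at `N = 27, 32, 64` — kernel-checked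
skeleton of the chain: HOME/es/g28/Derive-U-g28.lean f9e705fd59de3eb8 (`cuspSymbol_charTwist_mem_neronLattice_twist_oddPrime`, T-es-45).  Typed
here as OBLIGATION NODES so that the prover's theorem discharges them by name.  NOT asserted; grade (es 42.10/42.19): known-mechanism instance,
not a new combination.  BC5 WITNESS (es): HOME/es/g28/TWIST-OPT-CENSUS-v1.txt (engine 2) and MEMO-imc §12.3 (engine 1); DIAMOND-v1.txt
5d4361d2926e65a3 / EXACT-STAR-v1.txt e8c7142ddd790599 for the roots ((★) of 42.14 verified exactly on 27a/32a/64a).  REFUTER VERDICTS: ref1 R-es-62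
(U2/U3) PENDING at filing (BC7 CLEAN per es); ref2 R-es-64 PENDING.  CHEAPEST FALSIFIER (es): a unit-twist class `32D²`/`64D²`/`27D²` whose
X₀-optimal curve is not the minimal twist (none in Cremona's range per TWIST-OPT-CENSUS-v1).  WHY IT MATTERS: closes the period-lattice law
E-es-131 on the two families that the coordinate laws E-es-130/131 EXCLUDE at the roots (`D = 1` is exactly the excluded case `E₀ ≠ E_*`).
PARTITION currency: 0; beyond-print theorem: NO; bears_on: stmt-BirchSwinnertonDyer-22967 (C2) via the CM residual of the Kato road.  BSD is not
proved by this; Manin's conjecture is not proved by this; C2/C3 OPEN.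
[cite: Stevens1989Invent, Thm. (7.1), Lemma (5.2), Thm. (2.3) (Conjecture I″ for conductor ≤ 200; Néron lattice of a quadratic twist; the minimal curve — the print links of the chain; NOT these statements)]
-/

namespace Summit.BirchSwinnertonDyer.Rank1Residual.ManinAdditive.KatoCurve.CMOptimal


/-! ## §7  E-es-132-U2 / U3 — the period-lattice law on the unit-twist families (MEMO-es §42.19; lever: MEMO-imc §12)

THEOREM 42.19 (print + tree corollary; mechanism = the imc seat's LEMMA⁺ / squeeze, E-imc-15/16, PROVED in
`Literature/NumberTheory/EllipticCurves/Gamma1PeriodLatticeGamma0TwistProofs.lean`; the general law is E-imc-17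
`OptimalIsMinimalOfTwist`, `…/ManinAdditive/TwistRerootingLaws.lean`).  Let `K` be an isogeny class of conductor `M ≤ 200`,
`f` its newform, `E_* = E_*(K)` its minimal curve (Stevens 1989 Thm (2.3)), `D` squarefree, `D ≡ 1 (mod 4)`, `D ≠ 1`,
`gcd(D, M) = 1`, `g = f ⊗ χ_D` (level `N = M D²`, Atkin–Li).  Then `Λ(g; Γ₀(N)) = ℒ(E_* ⊗ χ_D)`, i.e. the `X₀(N)`-optimal
curve of `K ⊗ χ_D` is `E_* ⊗ χ_D` with Manin constant `±1`.  Chain: `Λ₀(g) ⊆ τ(χ_D)⁻¹ Λ₁(f)` (LEMMA⁺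
`GaussSumMulMemGamma1OfMemGamma0Twist_holds`) `= τ(χ_D)⁻¹ ℒ(E_*)` (Stevens 1989 THEOREM (7.1): Conjecture I″ `ℒ(f) = ℒ(A_min)`
holds for the 281 classes of conductor ≤ 200) `= ℒ(E_* ⊗ χ_D)` (Lemma (5.2), `η = 1`: tree theorem
`stevens1989_neronLattice_quadraticTwist_oddPrime_holds`, prime by prime) `= ℒ(E_*(K ⊗ χ_D))` (Cor (5.3)) `⊆ ℒ(E₀) = c₀ Λ₀(g)`
(Thm (2.3), lattice-optimal datum) ⇒ `c₀ = ±1`, `E₀ = E_* ⊗ χ_D`.  The two `Prop`s below are the instances `K = 32a`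
(`E_* = 32a2 = [0,0,0,−1,0]`), `K = 64a` (`E_* = 64a4 = [0,0,0,1,0]`), `K = 27a` (`E_* = 27a3 = [0,0,1,0,0]`) — they use only
the first three links (no optimality input); kernel-checked skeleton of the chain: HOME/es/g28/Derive-U-g28.lean
(`cuspSymbol_charTwist_mem_neronLattice_twist_oddPrime`).  What a prover still needs: the cite-tagged fact Stevens Thm (7.1)
at conductors 27, 32, 64 (statement-only), the Atkin–Li identification of the newform of `V` with `charTwist (M D²) … f`,
and the iteration of (5.2) over the prime factors of `D`.  (`D = 1`, the roots themselves, is exactly the excluded case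
`E₀(K) ≠ E_*(K)`.) -/

section UnitTwistFamilies

open scoped MatrixGroups ModularForm
open CongruenceSubgroup WeierstrassCurve Literature.NumberTheory.EllipticCurves
  Literature.NumberTheory.EllipticCurves.ModularForms

/-- **E-es-132-U2** — `V = [0,0,0,∓D²,0]`, `D ≡ 1 (mod 4)` squarefree, `D ≠ 1` (the minimal twists of `32a2 : y² = x³ − x` and
`64a4 : y² = x³ + x` by `χ_D`; conductors `32D²`, `64D²`): every `Γ₀(N)`-period of the newform of `V` lies in the Néron lattice
of `V`.  Instance of E-imc-17 ∧ `c₀ = 1` at the roots 32a/64a; PRINT + TREE COROLLARY by MEMO-es §42.19 (LEMMA⁺ + Stevens 1989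
Thm (7.1) at conductor 32/64 + Lemma (5.2) + Atkin–Li); census HOME/es/g28/TWIST-OPT-CENSUS-v1.txt (engine 2) and MEMO-imc §12.3
(engine 1).  LAW, nothing asserted in Lean. -/
@[conjecture] def CMPeriodLatticeLawTwoUnitTwists : Prop :=
  ∀ (V : WeierstrassCurve ℚ) [V.IsElliptic] [V.IsGloballyMinimal] {N : ℕ} [NeZero N]
    (f : CuspForm (Gamma0 N) 2) (L : PeriodPair) (D : ℤ),
    Squarefree D → D % 4 = 1 → D ≠ 1 →
    V.a₁ = 0 → V.a₂ = 0 → V.a₃ = 0 → (V.a₄ = -D ^ 2 ∨ V.a₄ = D ^ 2) → V.a₆ = 0 →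
    IsNewformOf V f → IsNeronLatticeOf (V.baseChange ℂ) L →
    ∀ γ : Gamma0 N, cuspSymbol f γ ∈ L.lattice

/-- **E-es-132-U3** — `V = [0,0,1,0,(D³−1)/4]`, `D ≡ 1 (mod 4)` squarefree, `3 ∤ D`, `D ≠ 1` (the minimal twist of
`27a3 : y² + y = x³` by `χ_D`; conductor `27D²`): every `Γ₀(N)`-period of the newform of `V` lies in the Néron lattice of `V`.
Instance of E-imc-17 ∧ `c₀ = 1` at the root 27a; PRINT + TREE COROLLARY by MEMO-es §42.19 (LEMMA⁺ + Stevens 1989 Thm (7.1) at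
conductor 27 + Lemma (5.2) + Atkin–Li); census HOME/es/g28/TWIST-OPT-CENSUS-v1.txt / MEMO-imc §12.3.  LAW, nothing asserted
in Lean. -/
@[conjecture] def CMPeriodLatticeLawThreeUnitTwists : Prop :=
  ∀ (V : WeierstrassCurve ℚ) [V.IsElliptic] [V.IsGloballyMinimal] {N : ℕ} [NeZero N]
    (f : CuspForm (Gamma0 N) 2) (L : PeriodPair) (D : ℤ),
    Squarefree D → D % 4 = 1 → ¬ (3 : ℤ) ∣ D → D ≠ 1 →
    V.a₁ = 0 → V.a₂ = 0 → V.a₃ = 1 → V.a₄ = 0 → 4 * V.a₆ = D ^ 3 - 1 →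
    IsNewformOf V f → IsNeronLatticeOf (V.baseChange ℂ) L →
    ∀ γ : Gamma0 N, cuspSymbol f γ ∈ L.lattice

end UnitTwistFamilies

end Summit.BirchSwinnertonDyer.Rank1Residual.ManinAdditive.KatoCurve.CMOptimal
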